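import Literature.AlgebraicGeometry.AbelianSchemes.PolarizationSpreadTransport
import Literature.AlgebraicGeometry.AbelianSchemes.LDeltaAmpleLocusOpen
import Literature.AlgebraicGeometry.AbelianSchemes.PolarizationOfLDeltaCubeLocus
import HarnessLib

/-!
# SPREAD SEQUEL (s2-λ), the `hopen` SWAP: a generic polarization spreads to a polarization over a finer stage, the openness of the
# polarization locus ([GortzWedhorn2023] Cor. 27.285) REPLACED by the ★ open ample locus of `L^Δ(λ)` + the pointwise residue «`L^Δ(λ)_z̄` ample ⇒ `λ̄_z̄ = Λ(ample)`» ([GortzWedhorn2023] Prop. 27.284)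

Layer `Literature/AlgebraicGeometry/AbelianSchemes`, namespaces `Literature.AlgebraicGeometry.Limits.LocApprox` (§1) and
`Literature.AlgebraicGeometry.AbelianSchemes.AbelianSchemeOver` (§2–§3).  THEOREMS ONLY (no definition, no named fact, no instance, no notation,
no `sorry`); §2–§3 at universe `Scheme.{0}` (the universe of ★ `AmpleLocusOpen`).  Cell `hodgecm-mathlib` (D-0151), FLOOR 0, P6 «MOD programme»
(crux hLiu418 = stmt-HodgeConjecture-24832), SPREAD door, item (s2-λ) «`hopen` SWAP» (LEAD F0P6-plan (g2) 2026-09-01 22:48:40Z: «B-p18 CONSUMES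
FILE 4 BY NAME»; B-p18 (g38)).  HC_CM is proved only modulo the printed citations until rung 0 closes; this file is generic and changes no count.

THE SWAP.  ★ `PolarizationSpreadStage.exists_stage_polarization_of_isOpen_locus` (p846971) carried the openness of the polarization locus of
`λ` as ONE opaque hypothesis `hopen` (Cor. 27.285 shape).  Cor. 27.285 = Thm. 24.46 (the ample locus of a LINE BUNDLE in a proper flat family is
open — now ★ «AmpleLocusOpen», B-p10 (g29): `AmpleLocusOpenAffine` p847032, `AmpleLocusOpen` p847047, `AbelianSchemeAmpleLocusOpen` p847065, and
its `L^Δ(λ)` reading ★ `LDeltaAmpleLocusOpen.exists_opens_forall_isAmple_iso_LDelta_of_isLambdaOfAt` p847074) + Prop. 27.284 («`λ` with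
`L^Δ(λ)_z̄ = (1, λ̄)^*𝒫_z̄` ample is a polarization at `z̄`», whose content at `z̄` is `Λ(L^Δ(λ)) = 2λ` and the SQUARE ROOT
«`λ̄² = Λ(ample) ⇒ λ̄ = Λ(ample′)`» — ★ G4 `IsLambdaOfAtSquareRoot` at characteristic `0`; [MumfordAV1970] §23 Thm. 3 at characteristic `p`).
Here the first is CONSUMED BY NAME and only the second is kept BY VALUE, as the pointwise hypothesis `h284` — so the remaining input of
(s2-λ) is exactly the printed residue at the geometric points of the stage, nothing more.

* §1 **`LocApprox.exists_stage_forall_geometricPoint_of_generic`** — the locus-to-stage lemma of ★ p846971 §1 with its two hypotheses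
  merged into the one actually used: every geometric point `ȳ` of the GENERIC base has an open neighbourhood `U ∋ ȳ ≫ (P ◁ π_t)` in the stage
  base all of whose geometric points satisfy `Q` ⇒ `Q` holds at every geometric point of a finer stage (★ `exists_stage_range_fst_subset`).
* §2 (universe `0`; `K` a field of characteristic `0` which is a localisation `A_S`, stage base `P ⊗ D(t)` locally Noetherian)
  **`exists_stage_polarization_of_ampleLocus`** — `𝒜` over `P ⊗ D(t)` with dual pair `D`, a homomorphism `λ : 𝒜 → Â` with graph `Gr`,
  (`hgen`) `λ̄ = Λ(ample)` at the geometric points of the generic base (★ p847043 supplies it from a generic polarization), and (`h284`) at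
  every geometric point `z̄` of the stage base «`L^Δ(λ)|_{A_z̄} ≅ 𝒪(Θ₂)` with `Θ₂` ample ⇒ `λ̄_z̄ = Λ(𝒪(Θ))` with `Θ` ample» ⇒ over some finer
  stage `λ` underlies a ★ `Polarization`.  Proof: at a generic geometric point `ȳ` (characteristic `0`, ★ `charZero_of_specMap_comp`) `hgen` is
  the witness of ★ FILE 4, whose open `U` is good by `h284`; §1; ★ p846971 §2.  **`exists_stage_polarization_of_sq_root`** — the same with
  `h284` split as (`hsq`) «`λ̄²_z̄ = Λ(𝒪(Θ₂))` for every `Θ₂` with `L^Δ(λ)|_{A_z̄} ≅ 𝒪(Θ₂)`» ([MumfordFogartyKirwan1994] Prop. 6.10 at `z̄`;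
  ★-assemblable from ★ `exists_isMonHom_classify_mumfordBundle_of_isLocallyNoetherian_base`, ★ `eq_mul_self_of_classify_mumfordBundle_LDelta`,
  ★ `isLambdaOfAt_of_classify_mumfordBundle_of_iso`) and (`hroot`) «`λ̄² = Λ(ample) ⇒ λ̄ = Λ(ample′)`» (★ G4 §5 at characteristic `0`).
* §3 (universe `0`; `A` a domain, `K = Frac A` of characteristic `0`, `P` qcqs, stages flat and locally Noetherian)
  **`exists_stage_polarization_of_polarization_of_ampleLocus`** — from a polarization `pol` of the GENERIC base change `(𝒜ₜ)_K`: ★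
  `exists_stage_monHom_hgen_of_polarization` (p847043: `σ : s₁ ⟶ t`, homomorphism `λ₁` restricting to `pol.lam`, `hgen`) + §2 at the stage `s₁`
  under `h284` for `λ₁` (quantified over the stage, the homomorphism and its graph, BY VALUE) ⇒ `ρ : s ⟶ s₁` and a ★ `Polarization` of
  `(𝒜ₜ|ₛ₁) ×_{P⊗D(s₁)} (P ⊗ D(s))` with `lam = λ₁ ×_{P⊗D(s₁)} (P ⊗ D(s))`.

## References
* [GortzWedhorn2023] U. Görtz, T. Wedhorn, *Algebraic Geometry II* (2023), Thm. 24.46 (p. 397), Prop. 27.284 and Cor. 27.285 (p. 723).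
* [MumfordFogartyKirwan1994] D. Mumford, J. Fogarty, F. Kirwan, *Geometric Invariant Theory*, 3rd ed. (1994), Ch. 6 §2 Def. 6.3 (p. 120),
  Prop. 6.10 (p. 121); Ch. 7 §2 Def. 7.2 (p. 129).
* [MumfordAV1970] D. Mumford, *Abelian Varieties* (1970), §23 Thm. 3 (p. 231).
* [EGAIV3] A. Grothendieck, J. Dieudonné, *EGA IV₃* (1966), Thm. 8.8.2 (i).
* [StacksProject] The Stacks Project, Tag 01Z3.
-/

set_option autoImplicit false

noncomputable section

universe u

open CategoryTheory CategoryTheory.Limits AlgebraicGeometry MonoidalCategory CartesianMonoidalCategory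
open scoped MonObj

/-! ## §1 The locus-to-stage lemma, generic-neighbourhood form -/

namespace Literature.AlgebraicGeometry.Limits

namespace LocApprox

open Literature.AlgebraicGeometry.Motives (SchemeOver specOver)

variable {A : Type u} [CommRing A] {S : Submonoid A} (B : Type u) [CommRing B] [Algebra A B] [IsLocalization S B]
  (P : SchemeOver A) [QuasiCompact P.hom]

/-- **A CONDITION ON GEOMETRIC POINTS WHICH HOLDS ON A NEIGHBOURHOOD OF EVERY GENERIC GEOMETRIC POINT HOLDS ON A FINER STAGE.**  `Q` a condition
on geometric points of the stage base `P ⊗ D(t)` (`P → Spec A` quasi-compact, `B = A_S`) such that every geometric point `ȳ` of the generic base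
`P ⊗ Spec B` has an open `U` of `P ⊗ D(t)` containing (the image of) `ȳ ≫ (P ◁ π_t)` with `Q` at EVERY geometric point landing in `U`.  THEN for
some `ρ : s ⟶ t`, `Q` holds at `z̄ ≫ (P ◁ D(ρ))` for every geometric point `z̄` of `P ⊗ D(s)`: the union of the good opens contains the image of
the generic base (a point `y` carries the geometric point `Spec κ(y)^alg`), hence the image of a finer stage (★ `exists_stage_range_fst_subset`,
[StacksProject, Tag 01Z3]).  The form of ★ `exists_stage_forall_geometricPoint` with `hopen` asked only where it is used.
[cite: GortzWedhorn2023, Cor. 27.285 (p. 723)] [cite: StacksProject, Tag 01Z3] -/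
theorem exists_stage_forall_geometricPoint_of_generic {t : Idx S}
    (Q : ∀ (Ω : Type u) [Field Ω] [IsAlgClosed Ω], (Spec (.of Ω) ⟶ (P ⊗ (baseDiagram S).obj t).left) → Prop)
    (h : ∀ (Ω : Type u) [Field Ω] [IsAlgClosed Ω] (yb : Spec (.of Ω) ⟶ (P ⊗ specOver A B).left),
      ∃ U : (P ⊗ (baseDiagram S).obj t).left.Opens, Set.range (yb ≫ (P ◁ leg S B t).left) ⊆ (U : Set _) ∧
        ∀ (Ω' : Type u) [Field Ω'] [IsAlgClosed Ω'] (zb : Spec (.of Ω') ⟶ (P ⊗ (baseDiagram S).obj t).left),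
          Set.range zb ⊆ (U : Set _) → Q Ω' zb) :
    ∃ (s : Idx S) (ρ : s ⟶ t), ∀ (Ω : Type u) [Field Ω] [IsAlgClosed Ω] (zb : Spec (.of Ω) ⟶ (P ⊗ (baseDiagram S).obj s).left),
      Q Ω (zb ≫ (P ◁ (baseDiagram S).map ρ).left) := by
  classical
  -- the union `W` of the opens all of whose geometric points satisfy `Q`
  let good : Set (P ⊗ (baseDiagram S).obj t).left.Opens := {U | ∀ (Ω : Type u) [Field Ω] [IsAlgClosed Ω]
    (zb : Spec (.of Ω) ⟶ (P ⊗ (baseDiagram S).obj t).left), Set.range zb ⊆ (U : Set _) → Q Ω zb}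
  let W : (P ⊗ (baseDiagram S).obj t).left.Opens := sSup good
  have hW : ∀ (Ω : Type u) [Field Ω] [IsAlgClosed Ω] (zb : Spec (.of Ω) ⟶ (P ⊗ (baseDiagram S).obj t).left),
      Set.range zb ⊆ (W : Set _) → Q Ω zb := by
    intro Ω _ _ zb hzb
    let p : ↥(Spec (.of Ω)) := IsLocalRing.closedPoint Ω
    have hp : zb p ∈ W := hzb ⟨p, rfl⟩
    obtain ⟨U, hU, hpU⟩ := TopologicalSpace.Opens.mem_sSup.1 hp
    refine hU Ω zb ?_
    rintro _ ⟨q, rfl⟩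
    rw [Subsingleton.elim q p]
    exact hpU
  -- `W` contains the image of the generic base
  have hc : pullback.fst (𝟙 (P ⊗ (baseDiagram S).obj t).left) (P ◁ (baseCone S B).π.app t).left =
      pullback.snd (𝟙 (P ⊗ (baseDiagram S).obj t).left) (P ◁ (baseCone S B).π.app t).left ≫ (P ◁ (baseCone S B).π.app t).left := by
    rw [← pullback.condition, Category.comp_id]
  have hgenW : Set.range (pullback.fst (𝟙 (P ⊗ (baseDiagram S).obj t).left) (P ◁ (baseCone S B).π.app t).left) ⊆ (W : Set _) := by
    rintro _ ⟨z, rfl⟩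
    rw [hc, Scheme.Hom.comp_apply]
    -- a geometric point over `y := snd z`: the algebraic closure of its residue field
    let y : ↥(P ⊗ specOver A B).left :=
      pullback.snd (𝟙 (P ⊗ (baseDiagram S).obj t).left) (P ◁ (baseCone S B).π.app t).left z
    let Ω : Type u := AlgebraicClosure ((P ⊗ specOver A B).left.residueField y)
    let yb : Spec (.of Ω) ⟶ (P ⊗ specOver A B).left :=
      Spec.map (CommRingCat.ofHom (algebraMap ((P ⊗ specOver A B).left.residueField y) Ω)) ≫
        (P ⊗ specOver A B).left.fromSpecResidueField y
    have hyb : yb (IsLocalRing.closedPoint Ω) = y := by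
      change (Spec.map _ ≫ (P ⊗ specOver A B).left.fromSpecResidueField y) _ = y
      rw [Scheme.Hom.comp_apply, Scheme.fromSpecResidueField_apply]
    obtain ⟨U, hxU, hU⟩ := h Ω yb
    have hyU : (P ◁ (baseCone S B).π.app t).left y ∈ U := by
      refine hxU ⟨IsLocalRing.closedPoint Ω, ?_⟩
      rw [Scheme.Hom.comp_apply, hyb]
      rfl
    exact TopologicalSpace.Opens.mem_sSup.2 ⟨U, hU, hyU⟩
  -- a finer stage lands in `W`
  haveI : QuasiCompact (Over.mk (𝟙 (P ⊗ (baseDiagram S).obj t).left)).hom := inferInstanceAs (QuasiCompact (𝟙 _))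
  obtain ⟨s, ρ, hs⟩ := exists_stage_range_fst_subset (B := B) P (Over.mk (𝟙 (P ⊗ (baseDiagram S).obj t).left)) W hgenW
  refine ⟨s, ρ, fun Ω _ _ zb => hW Ω _ ?_⟩
  rintro _ ⟨q, rfl⟩
  refine hs ⟨pullback.lift (P ◁ (baseDiagram S).map ρ).left (𝟙 _) (by simp) (zb q), ?_⟩
  have e1 := Scheme.Hom.comp_apply (pullback.lift (P ◁ (baseDiagram S).map ρ).left (𝟙 (P ⊗ (baseDiagram S).obj s).left) (by simp))
    (pullback.fst (𝟙 (P ⊗ (baseDiagram S).obj t).left) (P ◁ (baseDiagram S).map ρ).left) (zb q)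
  rw [pullback.lift_fst] at e1
  rw [Scheme.Hom.comp_apply]
  exact e1.symm

end LocApprox

end Literature.AlgebraicGeometry.Limits

/-! ## §2 The (s2-λ) head with `hopen` swapped for ★ `AmpleLocusOpen` + the Prop. 27.284 residue -/

namespace Literature.AlgebraicGeometry.AbelianSchemes

namespace AbelianSchemeOver

open Literature.AlgebraicGeometry.Motives Literature.AlgebraicGeometry.AbelianVarieties
open Literature.AlgebraicGeometry.Limits Literature.AlgebraicGeometry.Limits.LocApprox Literature.AlgebraicGeometry.Limits.OverFac

section Stage

variable {A : Type} [CommRing A] {S : Submonoid A} (K : Type) [Field K] [CharZero K] [Algebra A K] [IsLocalization S K]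
  {P : SchemeOver A} [QuasiCompact P.hom] {t : Idx S} [IsLocallyNoetherian (P ⊗ (baseDiagram S).obj t).left]
  (𝒜 : AbelianSchemeOver (P ⊗ (baseDiagram S).obj t).left) (D : 𝒜.DualPair) (lam : 𝒜.X ⟶ D.hat.X) [IsMonHom lam]
  (Gr : 𝒜.X.left ⟶ 𝒜.prodLeft D.hat) (hGr₁ : Gr ≫ pullback.fst 𝒜.X.hom D.hat.X.hom = 𝟙 _)
  (hGr₂ : Gr ≫ pullback.snd 𝒜.X.hom D.hat.X.hom = lam.left)

include hGr₁ hGr₂ in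
/-- **(s2-λ) HEAD, `hopen` SWAPPED: A HOMOMORPHISM `λ : 𝒜 → Â` OVER A STAGE BASE WHICH IS `Λ(ample)` AT THE GENERIC GEOMETRIC POINTS IS A
POLARIZATION OVER A FINER STAGE — given, at the geometric points of the stage, only the Prop. 27.284 residue.**  `K = A_S` a field of
characteristic `0`, `P → Spec A` quasi-compact, the stage base `P ⊗ D(t)` locally Noetherian, `𝒜` an abelian scheme over it with dual pair `D`,
`λ` a homomorphism with graph `Gr = (1, λ)`.  HYPOTHESES: (`hgen`) `λ̄ = Λ(𝒪(Θ))` with `Θ` ample at every geometric point coming from the generic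
base (★ `forall_exists_isAmple_isLambdaOfAt_leg_of_polarization`); (`h284`, BY VALUE) at every geometric point `z̄` of the stage base: if
`L^Δ(λ)|_{A_z̄} = z̄^*Gr^*𝒫 ≅ 𝒪(Θ₂)` with `Θ₂` ample then `λ̄_z̄ = Λ(𝒪(Θ))` for an ample `Θ` ([GortzWedhorn2023] Prop. 27.284 at `z̄`).  CONCLUSION:
for some `ρ : s ⟶ t`, `λ ×_{P⊗D(t)} (P ⊗ D(s))` underlies a ★ `Polarization` for the base-changed dual pair.  The openness of the ample locus of
`L^Δ(λ)` is ★ `exists_opens_forall_isAmple_iso_LDelta_of_isLambdaOfAt` (its characteristic-`0` witness is the generic geometric point, ★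
`charZero_of_specMap_comp`); §1; ★ `exists_polarization_baseChange_of_forall_isLambdaOfAt`.
[cite: GortzWedhorn2023, Thm. 24.46 (p. 397), Prop. 27.284 and Cor. 27.285 (p. 723)] [cite: MumfordFogartyKirwan1994, Ch. 6 §2 Definition 6.3 (p. 120)] -/
theorem exists_stage_polarization_of_ampleLocus
    (hgen : ∀ (Ω : Type) [Field Ω] [IsAlgClosed Ω] (yb : Spec (.of Ω) ⟶ (P ⊗ specOver A K).left),
      ∃ Θ : CartierDivisor (𝒜.fibre (yb ≫ (P ◁ leg S K t).left)).toAbelianVariety.X.left,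
        Θ.IsAmple ∧ 𝒜.IsLambdaOfAt (yb ≫ (P ◁ leg S K t).left) D lam Θ)
    (h284 : ∀ (Ω : Type) [Field Ω] [IsAlgClosed Ω] (zb : Spec (.of Ω) ⟶ (P ⊗ (baseDiagram S).obj t).left)
      (Θ₂ : CartierDivisor (𝒜.fibre zb).toAbelianVariety.X.left), Θ₂.IsAmple →
      Nonempty ((Scheme.Modules.pullback (pullback.fst 𝒜.X.hom zb)).obj ((Scheme.Modules.pullback Gr).obj D.P) ≅
        𝒜.lineBundleOfDivisor zb Θ₂) →
      ∃ Θ : CartierDivisor (𝒜.fibre zb).toAbelianVariety.X.left, Θ.IsAmple ∧ 𝒜.IsLambdaOfAt zb D lam Θ) :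
    ∃ (s : Idx S) (ρ : s ⟶ t) (pol : (𝒜.baseChange (stageOver S P ρ).hom).Polarization (D.baseChange (stageOver S P ρ).hom)),
      pol.lam = (Over.pullback (stageOver S P ρ).hom).map lam := by
  obtain ⟨s, ρ, hs⟩ := exists_stage_forall_geometricPoint_of_generic K P
    (fun Ω _ _ zb => ∃ Θ : CartierDivisor (𝒜.fibre zb).toAbelianVariety.X.left, Θ.IsAmple ∧ 𝒜.IsLambdaOfAt zb D lam Θ)
    (fun Ω _ _ yb => by
      -- the generic geometric point has characteristic `0`
      haveI : CharZero Ω := charZero_of_specMap_comp (pullback.snd P.hom (specOver A K).hom) yb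
      obtain ⟨Θ, hΘ, hΛ⟩ := hgen Ω yb
      obtain ⟨U, hxU, hU⟩ := 𝒜.exists_opens_forall_isAmple_iso_LDelta_of_isLambdaOfAt D Gr hGr₁ hGr₂
        ((yb ≫ (P ◁ leg S K t).left) (IsLocalRing.closedPoint Ω)) (yb ≫ (P ◁ leg S K t).left) ⟨_, rfl⟩ hΘ hΛ
      refine ⟨U, ?_, fun Ω' _ _ zb hzb => ?_⟩
      · rintro _ ⟨q, rfl⟩
        rw [Subsingleton.elim q (IsLocalRing.closedPoint Ω)]
        exact hxU
      · obtain ⟨Θ₂, hΘ₂, e⟩ := hU Ω' zb hzb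
        exact h284 Ω' zb Θ₂ hΘ₂ e)
  exact ⟨s, ρ, exists_polarization_baseChange_of_forall_isLambdaOfAt 𝒜 (stageOver S P ρ).hom D lam hs⟩

include hGr₁ hGr₂ in
/-- **The same head with the Prop. 27.284 residue SPLIT** into its two printed halves: (`hsq`, [MumfordFogartyKirwan1994] Prop. 6.10 at the
geometric points of the stage) «`λ̄² = Λ(𝒪(Θ₂))` whenever `L^Δ(λ)|_{A_z̄} ≅ 𝒪(Θ₂)`», and (`hroot`, [GortzWedhorn2023] Prop. 27.284 ∕ [MumfordAV1970]
§23 Thm. 3; ★ G4 `IsLambdaOfAtSquareRoot` at characteristic `0`) «`λ̄² = Λ(𝒪(Θ₂))` with `Θ₂` ample ⇒ `λ̄ = Λ(𝒪(Θ))` with `Θ` ample».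
[cite: GortzWedhorn2023, Prop. 27.284 (p. 723)] [cite: MumfordFogartyKirwan1994, Ch. 6 §2 Prop. 6.10 (p. 121)] [cite: MumfordAV1970, §23 Thm. 3 (p. 231)] -/
theorem exists_stage_polarization_of_sq_root
    (hgen : ∀ (Ω : Type) [Field Ω] [IsAlgClosed Ω] (yb : Spec (.of Ω) ⟶ (P ⊗ specOver A K).left),
      ∃ Θ : CartierDivisor (𝒜.fibre (yb ≫ (P ◁ leg S K t).left)).toAbelianVariety.X.left,
        Θ.IsAmple ∧ 𝒜.IsLambdaOfAt (yb ≫ (P ◁ leg S K t).left) D lam Θ)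
    (hsq : ∀ (Ω : Type) [Field Ω] [IsAlgClosed Ω] (zb : Spec (.of Ω) ⟶ (P ⊗ (baseDiagram S).obj t).left)
      (Θ₂ : CartierDivisor (𝒜.fibre zb).toAbelianVariety.X.left),
      Nonempty ((Scheme.Modules.pullback (pullback.fst 𝒜.X.hom zb)).obj ((Scheme.Modules.pullback Gr).obj D.P) ≅
        𝒜.lineBundleOfDivisor zb Θ₂) → 𝒜.IsLambdaOfAt zb D (lam ^ 2) Θ₂)
    (hroot : ∀ (Ω : Type) [Field Ω] [IsAlgClosed Ω] (zb : Spec (.of Ω) ⟶ (P ⊗ (baseDiagram S).obj t).left)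
      (Θ₂ : CartierDivisor (𝒜.fibre zb).toAbelianVariety.X.left), Θ₂.IsAmple → 𝒜.IsLambdaOfAt zb D (lam ^ 2) Θ₂ →
      ∃ Θ : CartierDivisor (𝒜.fibre zb).toAbelianVariety.X.left, Θ.IsAmple ∧ 𝒜.IsLambdaOfAt zb D lam Θ) :
    ∃ (s : Idx S) (ρ : s ⟶ t) (pol : (𝒜.baseChange (stageOver S P ρ).hom).Polarization (D.baseChange (stageOver S P ρ).hom)),
      pol.lam = (Over.pullback (stageOver S P ρ).hom).map lam :=
  𝒜.exists_stage_polarization_of_ampleLocus K D lam Gr hGr₁ hGr₂ hgen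
    fun Ω _ _ zb Θ₂ hΘ₂ e => hroot Ω zb Θ₂ hΘ₂ (hsq Ω zb Θ₂ e)

end Stage

/-! ## §3 Over a domain: from a GENERIC polarization to a polarization over a finer stage, `hopen` swapped -/

section Assembly

variable {A : Type} [CommRing A] [IsDomain A] (K : Type) [Field K] [CharZero K] [Algebra A K] [IsFractionRing A K]
  {P : SchemeOver A} [QuasiCompact P.hom] [QuasiSeparated P.hom]
  [∀ s : Idx (nonZeroDivisors A), IsLocallyNoetherian (P ⊗ (baseDiagram (nonZeroDivisors A)).obj s).left]
  {t : Idx (nonZeroDivisors A)}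
  (𝒜ₜ : AbelianSchemeOver (P ⊗ (baseDiagram (nonZeroDivisors A)).obj t).left) (Dₜ : 𝒜ₜ.DualPair)
  (pol : (𝒜ₜ.baseChange (genOver (nonZeroDivisors A) K P t).hom).Polarization (Dₜ.baseChange (genOver (nonZeroDivisors A) K P t).hom))

/-- **A GENERIC POLARIZATION SPREADS TO A POLARIZATION TWO STAGES DOWN, `hopen` SWAPPED** (`A` a domain, `K = Frac A` of characteristic `0`,
`P` qcqs over `A`, the stages `P ⊗ D(s)` locally Noetherian, the stage `t` flat): from `pol` a polarization of `(𝒜ₜ)_K` for the base-changed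
dual pair, ★ `exists_stage_monHom_hgen_of_polarization` gives `σ : s₁ ⟶ t`, a homomorphism `λ₁ : 𝒜ₜ|ₛ₁ → Âₜ|ₛ₁` restricting to `pol.lam`
(★ `facObjIso` clause) and `hgen`; §2 at the stage `s₁` under the Prop. 27.284 residue `h284` for `λ₁` (BY VALUE, quantified over the stage,
the homomorphism and its graph) gives `ρ : s ⟶ s₁` and a ★ `Polarization` of `(𝒜ₜ|ₛ₁) ×_{P⊗D(s₁)} (P ⊗ D(s))` with
`lam = λ₁ ×_{P⊗D(s₁)} (P ⊗ D(s))`. [cite: GortzWedhorn2023, Prop. 27.284 and Cor. 27.285 (p. 723)] [cite: EGAIV3, Thm. 8.8.2 (i)]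
[cite: MumfordFogartyKirwan1994, Ch. 6 §2 Definition 6.3 (p. 120)] -/
theorem exists_stage_polarization_of_polarization_of_ampleLocus
    [Flat (pullback.snd P.hom ((baseDiagram (nonZeroDivisors A)).obj t).hom)]
    (h284 : ∀ (s₁ : Idx (nonZeroDivisors A)) (σ : s₁ ⟶ t)
      (lam : (𝒜ₜ.baseChange (stageOver (nonZeroDivisors A) P σ).hom).X ⟶ (Dₜ.baseChange (stageOver (nonZeroDivisors A) P σ).hom).hat.X)
      [IsMonHom lam]
      (Gr : (𝒜ₜ.baseChange (stageOver (nonZeroDivisors A) P σ).hom).X.left ⟶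
        (𝒜ₜ.baseChange (stageOver (nonZeroDivisors A) P σ).hom).prodLeft (Dₜ.baseChange (stageOver (nonZeroDivisors A) P σ).hom).hat),
      Gr ≫ pullback.fst _ _ = 𝟙 _ → Gr ≫ pullback.snd _ _ = lam.left →
      ∀ (Ω : Type) [Field Ω] [IsAlgClosed Ω] (zb : Spec (.of Ω) ⟶ (P ⊗ (baseDiagram (nonZeroDivisors A)).obj s₁).left)
        (Θ₂ : CartierDivisor ((𝒜ₜ.baseChange (stageOver (nonZeroDivisors A) P σ).hom).fibre zb).toAbelianVariety.X.left), Θ₂.IsAmple →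
        Nonempty ((Scheme.Modules.pullback (pullback.fst (𝒜ₜ.baseChange (stageOver (nonZeroDivisors A) P σ).hom).X.hom zb)).obj
          ((Scheme.Modules.pullback Gr).obj (Dₜ.baseChange (stageOver (nonZeroDivisors A) P σ).hom).P) ≅
          (𝒜ₜ.baseChange (stageOver (nonZeroDivisors A) P σ).hom).lineBundleOfDivisor zb Θ₂) →
        ∃ Θ : CartierDivisor ((𝒜ₜ.baseChange (stageOver (nonZeroDivisors A) P σ).hom).fibre zb).toAbelianVariety.X.left,
          Θ.IsAmple ∧ (𝒜ₜ.baseChange (stageOver (nonZeroDivisors A) P σ).hom).IsLambdaOfAt zb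
            (Dₜ.baseChange (stageOver (nonZeroDivisors A) P σ).hom) lam Θ) :
    ∃ (s₁ : Idx (nonZeroDivisors A)) (σ : s₁ ⟶ t)
      (lam₁ : (𝒜ₜ.baseChange (stageOver (nonZeroDivisors A) P σ).hom).X ⟶ (Dₜ.baseChange (stageOver (nonZeroDivisors A) P σ).hom).hat.X)
      (_ : IsMonHom lam₁)
      (_ : (Over.pullback (relLeg (nonZeroDivisors A) K P σ).left).map lam₁ ≫ (facObjIso (relLeg (nonZeroDivisors A) K P σ) Dₜ.hat.X).hom =
        (facObjIso (relLeg (nonZeroDivisors A) K P σ) 𝒜ₜ.X).hom ≫ pol.lam)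
      (s : Idx (nonZeroDivisors A)) (ρ : s ⟶ s₁)
      (pol₁ : ((𝒜ₜ.baseChange (stageOver (nonZeroDivisors A) P σ).hom).baseChange (stageOver (nonZeroDivisors A) P ρ).hom).Polarization
        ((Dₜ.baseChange (stageOver (nonZeroDivisors A) P σ).hom).baseChange (stageOver (nonZeroDivisors A) P ρ).hom)),
      pol₁.lam = (Over.pullback (stageOver (nonZeroDivisors A) P ρ).hom).map lam₁ := by
  obtain ⟨s₁, σ, lam₁, hmon, hz, hgen⟩ := exists_stage_monHom_hgen_of_polarization K 𝒜ₜ Dₜ pol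
  haveI := hmon
  -- the graph of `λ₁`
  let 𝒜₁ := 𝒜ₜ.baseChange (stageOver (nonZeroDivisors A) P σ).hom
  let D₁ := Dₜ.baseChange (stageOver (nonZeroDivisors A) P σ).hom
  obtain ⟨Gr, hGr₁, hGr₂⟩ : ∃ Gr : 𝒜₁.X.left ⟶ 𝒜₁.prodLeft D₁.hat,
      Gr ≫ pullback.fst 𝒜₁.X.hom D₁.hat.X.hom = 𝟙 _ ∧ Gr ≫ pullback.snd 𝒜₁.X.hom D₁.hat.X.hom = lam₁.left :=
    ⟨pullback.lift (𝟙 _) lam₁.left (by rw [Category.id_comp, Over.w]), pullback.lift_fst _ _ _, pullback.lift_snd _ _ _⟩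
  -- (`[IsMonHom lam₁]` is passed by term: the base `(stageOver σ).left` is `(P ⊗ D(s₁)).left` only up to unfolding)
  obtain ⟨s, ρ, pol₁, hpol₁⟩ := @exists_stage_polarization_of_ampleLocus A _ (nonZeroDivisors A) K _ _ _ _ P _ s₁ _ 𝒜₁ D₁ lam₁ hmon
    Gr hGr₁ hGr₂ hgen (h284 s₁ σ lam₁ Gr hGr₁ hGr₂)
  exact ⟨s₁, σ, lam₁, hmon, hz, s, ρ, pol₁, hpol₁⟩

end Assembly

end AbelianSchemeOver

end Literature.AlgebraicGeometry.AbelianSchemes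

end
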